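import Summits.QuantumFields.BalabanUV.T4Continuum.Support.VariationalColourTaxiTowerBridge
import Summits.QuantumFields.BalabanUV.T4Continuum.Support.OneMinTransfer
import Summits.QuantumFields.BalabanUV.T4Continuum.Support.VariationalVectorOneMinCentred

/-!
# T⁴ programme, spine node NE2 (U1a), lane P2 — (ONE-min) AT BAŁABAN's TAXI DATA: the END's `hONEm k` of parts 6–8 ⇐ the centred supplier's shape, through the
# composite-fibre ↔ taxi-frame bridge (item «ONE-MIN AT TAXI DATA — THE COMPOSITE-FIBRE ↔ TAXI-FRAME BRIDGE», file 4b = THE ASSEMBLY; model level; cell `pub-balaban`)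

NE2 formalisation swarm `b2b-balaban-t4-ne2-formalise-*`, leaf prover 04 GEN 7 (`prover-b2b-balaban-t4-ne2-formalise-leaf-04-g7-0`); register row «P2-sup» of
`t4/formal/NE2/LEAVES.md`; journal CLAIMS.log INTENT 2026-08-20 l.21025.  Composition BY NAME of file 3 `OneMinTransfer.hONEm_transfer` (p237277) with file 4a's three
comparison data at taxi data `VariationalColourTaxiTowerBridge.{hG12_taxi, hQ12_taxi, hUBf2_taxi, hPf2_taxi, hGar_succ_oneStep}`, leaf-01-g8's `VariationalVectorOneMinCentred.
QvL_QvL_add` and leaf-09-g7's `VariationalVectorGaugeMove.sqrt_projG_add_le`.  Nothing defined.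

THE STATEMENT ([folklore]; `E = ℂ` as in parts 6–8; level `k` FIXED, every class ∕ smallness hypothesis DISPLAYED per level exactly as in part 6 §1).  Letters as in
file 4a: `T := taxiTv (L^k) M (Rlev k)`, `T′ := taxiTv L (fine (L^k) M) (R′ k)`, `Q_k := QvL (L^k) M (nestLv k)`, `G := projG (Rlev k) (ker Q_T)` (= part 6's `G k`),
the END's (`Q₂ := QvL L _ (lineT L _ T′ (R′ k))`, `G₂′ := projG (Rlev (k+1)) (ker Q_{taxiTv (Rlev (k+1))}) ∘ (· ∘ sites)`) and the supplier's (`Q₁ := QvL L _ (frameT L _ T′ (Rlev k))`,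
`G₁′ := projG (R′ k) (ker (Q_T ∘ Q_{T′}))`).
 * **`hONEm_taxi_of_centred`**: GIVEN the supplier's conclusion SHAPE at level `k` — `hONEc : ∀ φ W₀, Q_k W₀ = φ → (W₀ minimises ScV (Rlev k) G in the fibre) →
   ∃ g, Q_k(Q₁ g) = φ ∧ SfV (R′ k) G₁′ g ≤ (√(S + ε(S + nsqV φ)) + δ′√(qWV W₀))²` (this IS the conclusion of leaf-01-g9's `VariationalVectorOneMinCentredReg.hONEm_centred_reg`
   at `n := L^k`, `Rc := Rlev k`, `R′ := R′ k`, `T`, `T′`, `T_k := nestLv k`, with its `ε⋆`, `δ′ = √(8d(1+d²))·(L^k·L·m₁)`) —, the DISPLAYED (GF3)_{k+1} for the straight-taxi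
   kernel (part 6's `hGdiv (k+1)` letter) and the level-(k+1) class ∕ smallness lines of parts 4 ∕ 10, free `u, w > 0` and the two transfer smallness conditions
   `v_k := (1+u⁻¹)δ_k²·d(κ+κ′) ≤ ⅛`, `γ_k := γ₀,k²·C_Pf ≤ ¼` (`δ_k = 4·d(d(L(L^k−1)(L−1)b_k))·revPC d (L^k·L) w_k` — O(d³36^d·c∕L^k) under the class —, `γ₀,k = 3(d−1)L(L−1)b_k` —
   O((d−1)c∕L^{2k}) —, `κ = 2(1+C_D)`, `κ′ = 2(C_D′ + 64d(L^{k+1})²b_k)`, `C_Pf = max(40κ, 64+40κ′)`), THEN the END's socket at level `k` IN ITS OWN LETTERS: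
   `∀ φ W₀, Q_k W₀ = φ → IsMin → ∃ g, Q_k(Q₂ g) = φ ∧ SfV (R′ k) G₂′ g ≤ (√(S + ε₂(S + nsqV φ)) + (√A·δ′)√(qWV W₀))²` with file 3's `ε₂ = (A−1) + Aε + B`,
   `A = (1 + w + (1+w⁻¹)Λ_fγ_k(1+4γ_k))(1+4v_k)(1+u)`, `B = (…)(1+4v_k)(4v_k) + 4(1+w⁻¹)Λ_fγ_k`, `Λ_f` = gen 5's fine V-UB constant.  Every summand of `ε₂ − ε` carries
   `u`, `w`, `δ_k²` or `γ₀,k²`: with `u_k = w_k = θ^k` the END's geometric summability `ε₁ k ≤ c_ε θ^k` is preserved (the class bookkeeping is the consumer's, as in part 7).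
WHAT THIS CLOSES ∕ LEAVES.  It closes the JUNCTION: the `hONEm k` binder displayed by `effV_tendsto_taxiTower_projG(_regular)_of_class` (p229644 ∕ p232805) is now the
supplier's shape + (GF3)_{k+1} (supplied under the regular presentation by part 7's `hGdiv_projG_nestLv_regular`) + classes.  It does NOT discharge the supplier's own
displayed leaves at taxi data (the colour scalar pair's UB⁺∕P⁺∕REG⁺ at (`T`, `T′`), the vector fine V-UB for (`Q₁`, `G₁′`), V-P∕(Går)∕(GF3)∕V-REG for `G` — the last four ARE
part 6 §1's sockets) — the courier that plugs `hONEm_centred_reg` is the next file.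

HONEST FRAMING (T4-DAG p. 1).  Rung (B)+1 only — NOT infinite volume, NOT a mass gap, NOT Clay.  NE2 NOT IN PRINT, NOT proved here.  MODEL LEVEL (c5): bond ∕ site operators
DATA, taxi contours, carriers and both gauge fixings OURS; bookkeeping ([folklore]); thresholds via `revPC` quantitatively void; nothing printed is a hypothesis; no `def`,
no `def … : Prop`, no `sorry`; axioms standard.  V-END with background ∕ NE2 NOT proved; NE3 OPEN; spine PROVED 0∕9 unchanged.  HONEST DEPENDENCY (cell, verbatim):
continuum YM on T⁴ ⇐ BetaPertH ∧ nine spine estimates (0/9 proved); BetaPertH ⇐ (D1) ∧ (D4) ∧ CAP+tail; G-an2-4 gates asym, D1 and NE2/3/4.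
-/

noncomputable section

namespace Summit.QuantumFields.BalabanUV.T4Continuum.VariationalColourTaxiTransport

open Finset
open Literature.MathematicalPhysics.QuantumFieldTheory.Balaban1983to89.B5Prop11Plancherel (Tor fine unitVec)
open Literature.MathematicalPhysics.QuantumFieldTheory.Balaban1983to89.B5Composition116 (sites)
open Summit.QuantumFields.BalabanUV.T4Continuum.VariationalColourTower (Rtrv)
open Summit.QuantumFields.BalabanUV.T4Continuum.VariationalVectorFederbush (lineT)
open Summit.QuantumFields.BalabanUV.T4Continuum.VariationalVectorInterpolant (frameT)
open Summit.QuantumFields.BalabanUV.T4Continuum.VectorBlockTrialForm (nsqV nsqV_nonneg QvL kappaV)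
open Summit.QuantumFields.BalabanUV.T4Continuum.VariationalVectorForm (ScV SfV qWV qVV lamV lamV_nonneg)
open Summit.QuantumFields.BalabanUV.T4Continuum.VariationalVectorWeitzenbock (divSq)
open Summit.QuantumFields.BalabanUV.T4Continuum.VariationalVectorGaugeSlice (avgOp projG projG_nonneg)
open Summit.QuantumFields.BalabanUV.T4Continuum.VariationalVectorGaugeMove (sqrt_projG_add_le)
open Summit.QuantumFields.BalabanUV.T4Continuum.CovariantBlockReversePoincare (revPC revPC_nonneg)
open Summit.QuantumFields.BalabanUV.T4Continuum.VariationalVectorOneMinCentred (QvL_QvL_add)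
open Summit.QuantumFields.BalabanUV.T4Continuum.OneMinTransfer (hONEm_transfer)

variable {d : ℕ}
variable (L : ℕ) [NeZero L] (M : Fin d → ℕ) [hM : ∀ μ, NeZero (M μ)]
variable {R' : (k : ℕ) → Tor (fine L (fine (L ^ k) M)) → Fin d → (ℂ →L[ℂ] ℂ)} (hU : ∀ k x μ, R' k x μ ∈ unitary (ℂ →L[ℂ] ℂ)) {b : ℕ → ℝ}
  (hb : ∀ k x κ ι, ‖R' k x κ * R' k (x + unitVec (fine L (fine (L ^ k) M)) κ) ι - R' k x ι * R' k (x + unitVec (fine L (fine (L ^ k) M)) ι) κ‖ ≤ b k)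
  (hcoh : ∀ k, coarseTv L (fine (L ^ (k + 1)) M) (R' (k + 1)) = Rtrv (L ^ k) L M (R' k))
include hU hb hcoh

/-- **(ONE-min) AT BAŁABAN's TAXI DATA FROM THE CENTRED SUPPLIER's SHAPE** (level `k`): see the module docstring for the letters; the conclusion is the `hONEm k` binder of
parts 6–8 (`effV_tendsto_taxiTower_projG(_regular)_of_class`) with `ρV k := ScV + nsqV∘Q_k`, `ε₁ k := ε₂`, `δ′ k := √A·δ′`. [folklore] -/
theorem hONEm_taxi_of_centred (hd : 1 ≤ d) (hM2 : ∀ μ, 1 < M μ) (k : ℕ) {a : ℝ} (ha0 : 0 ≤ a)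
    (ha : ∀ x κ ι, ‖Rlev L M R' k x κ * Rlev L M R' k (x + unitVec (fine (L ^ k) M) κ) ι - Rlev L M R' k x ι * Rlev L M R' k (x + unitVec (fine (L ^ k) M) ι) κ‖ ≤ a)
    (hb0 : 0 ≤ b k)
    -- the level-(k+1) class ∕ smallness lines (parts 4 ∕ 10 letters)
    (hsmall : 2 * (d : ℝ) * ((((L ^ (k + 1) : ℕ) : ℝ)) * (((d - 1 : ℕ) : ℝ) * ((L ^ (k + 1) - 1 : ℕ) : ℝ) * b k)) ^ 2 ≤ 1 / 2)
    (hγs : 64 * (∑ q ∈ Finset.range (k + 1), ((((d - 1 : ℕ) : ℝ) + (d : ℝ) * d) * (((L : ℝ) * ((L ^ q - 1 : ℕ) : ℝ) * ((L - 1 : ℕ) : ℝ)) * b q))) ^ 2 ≤ 1)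
    (hsmall80 : 2 * 40 * ((d : ℝ) * ((((L ^ (k + 1) : ℕ) : ℝ)) ^ 2 * b k)) ≤ 1)
    (hc : (kappaV d (L ^ (k + 1)))⁻¹ * ((∑ q ∈ Finset.range (k + 1), ((((d - 1 : ℕ) : ℝ) + (d : ℝ) * d) * (((L : ℝ) * ((L ^ q - 1 : ℕ) : ℝ) * ((L - 1 : ℕ) : ℝ)) * b q)))
        + 3 * (((d - 1 : ℕ) : ℝ) * (L ^ (k + 1) : ℕ) * ((L ^ (k + 1) - 1 : ℕ) : ℝ) * b k)) < 1)
    -- the DISPLAYED (GF3)_{k+1} for the straight-taxi kernel (part 6's letter)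
    {CD CD' : ℝ} (hCD : 0 ≤ CD) (hCD' : 0 ≤ CD')
    (hGdiv : ∀ W, ((((L ^ (k + 1) : ℕ) : ℝ)) ^ d)⁻¹ * ((((L ^ (k + 1) : ℕ) : ℝ)) ^ 2 * divSq (fine (L ^ (k + 1)) M) (Rlev L M R' (k + 1)) W)
      ≤ CD * ScV (L ^ (k + 1)) M (Rlev L M R' (k + 1)) (projG (fine (L ^ (k + 1)) M) (Rlev L M R' (k + 1))
          (LinearMap.ker (avgOp (L ^ (k + 1)) M (taxiTv (L ^ (k + 1)) M (Rlev L M R' (k + 1)))))) W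
        + CD' * nsqV M (QvL (L ^ (k + 1)) M (nestLv L M R' (k + 1)) W))
    -- the supplier's conclusion SHAPE at level k (leaf-01-g9's `hONEm_centred_reg`)
    {ε δ' : ℝ} (hε : 0 ≤ ε) (hδ' : 0 ≤ δ')
    (hONEc : ∀ (φ : Tor M → Fin d → ℂ) (W₀ : Tor (fine (L ^ k) M) → Fin d → ℂ), QvL (L ^ k) M (nestLv L M R' k) W₀ = φ →
      (∀ W, QvL (L ^ k) M (nestLv L M R' k) W = φ →
        ScV (L ^ k) M (Rlev L M R' k) (projG (fine (L ^ k) M) (Rlev L M R' k) (LinearMap.ker (avgOp (L ^ k) M (taxiTv (L ^ k) M (Rlev L M R' k))))) W₀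
          ≤ ScV (L ^ k) M (Rlev L M R' k) (projG (fine (L ^ k) M) (Rlev L M R' k) (LinearMap.ker (avgOp (L ^ k) M (taxiTv (L ^ k) M (Rlev L M R' k))))) W) →
      ∃ g, QvL (L ^ k) M (nestLv L M R' k) (QvL L (fine (L ^ k) M) (frameT L (fine (L ^ k) M) (taxiTv L (fine (L ^ k) M) (R' k)) (Rlev L M R' k)) g) = φ ∧
        SfV (L ^ k) L M (R' k) (projG (fine L (fine (L ^ k) M)) (R' k)
            (LinearMap.ker ((avgOp (L ^ k) M (taxiTv (L ^ k) M (Rlev L M R' k))).comp (avgOp L (fine (L ^ k) M) (taxiTv L (fine (L ^ k) M) (R' k)))))) g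
          ≤ (Real.sqrt (ScV (L ^ k) M (Rlev L M R' k) (projG (fine (L ^ k) M) (Rlev L M R' k) (LinearMap.ker (avgOp (L ^ k) M (taxiTv (L ^ k) M (Rlev L M R' k))))) W₀
                + ε * (ScV (L ^ k) M (Rlev L M R' k) (projG (fine (L ^ k) M) (Rlev L M R' k) (LinearMap.ker (avgOp (L ^ k) M (taxiTv (L ^ k) M (Rlev L M R' k))))) W₀
                  + nsqV M φ))
              + δ' * Real.sqrt (qWV (L ^ k) M W₀)) ^ 2)
    -- the free parameters and the two smallness conditions of the transfer
    {u w : ℝ} (hu : 0 < u) (hw : 0 < w)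
    (hv : (1 + u⁻¹) * (4 * ((d : ℝ) * ((d : ℝ) * (((L : ℝ) * ((L ^ k - 1 : ℕ) : ℝ) * ((L - 1 : ℕ) : ℝ)) * b k)))
          * revPC d (L ^ k * L) (((d - 1 : ℕ) : ℝ) * ((L - 1 : ℕ) : ℝ) * ((2 * L - 1 : ℕ) : ℝ) * b k + ((d - 1 : ℕ) : ℝ) * ((L ^ k - 1 : ℕ) : ℝ) * a)) ^ 2
        * ((d : ℝ) * (2 * (1 + CD) + 2 * (CD' + d * ((((L ^ (k + 1) : ℕ) : ℝ)) ^ 2 * b k) * 64))) ≤ 1 / 8)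
    (hγ : (3 * (((d - 1 : ℕ) : ℝ) * L * ((L - 1 : ℕ) : ℝ) * b k)) ^ 2 * max (40 * (2 * (1 + CD))) (64 + 40 * (2 * (CD' + d * ((((L ^ (k + 1) : ℕ) : ℝ)) ^ 2 * b k) * 64))) ≤ 1 / 4) :
    let v : ℝ := (1 + u⁻¹) * (4 * ((d : ℝ) * ((d : ℝ) * (((L : ℝ) * ((L ^ k - 1 : ℕ) : ℝ) * ((L - 1 : ℕ) : ℝ)) * b k)))
          * revPC d (L ^ k * L) (((d - 1 : ℕ) : ℝ) * ((L - 1 : ℕ) : ℝ) * ((2 * L - 1 : ℕ) : ℝ) * b k + ((d - 1 : ℕ) : ℝ) * ((L ^ k - 1 : ℕ) : ℝ) * a)) ^ 2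
        * ((d : ℝ) * (2 * (1 + CD) + 2 * (CD' + d * ((((L ^ (k + 1) : ℕ) : ℝ)) ^ 2 * b k) * 64)))
    let γ : ℝ := (3 * (((d - 1 : ℕ) : ℝ) * L * ((L - 1 : ℕ) : ℝ) * b k)) ^ 2 * max (40 * (2 * (1 + CD))) (64 + 40 * (2 * (CD' + d * ((((L ^ (k + 1) : ℕ) : ℝ)) ^ 2 * b k) * 64)))
    let Λf : ℝ := lamV d ((L ^ (k + 1) : ℕ) * (((d - 1 : ℕ) : ℝ) * ((L ^ (k + 1) - 1 : ℕ) : ℝ) * b k)) d (((L ^ (k + 1) : ℕ) : ℝ) ^ 2 * 0)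
          / (1 - (kappaV d (L ^ (k + 1)))⁻¹ * ((∑ q ∈ Finset.range (k + 1), ((((d - 1 : ℕ) : ℝ) + (d : ℝ) * d) * (((L : ℝ) * ((L ^ q - 1 : ℕ) : ℝ) * ((L - 1 : ℕ) : ℝ)) * b q)))
              + 3 * (((d - 1 : ℕ) : ℝ) * (L ^ (k + 1) : ℕ) * ((L ^ (k + 1) - 1 : ℕ) : ℝ) * b k))) ^ 2
    let A : ℝ := (1 + w + (1 + w⁻¹) * (Λf * γ) * (1 + 4 * γ)) * (1 + 4 * v) * (1 + u)
    let B : ℝ := (1 + w + (1 + w⁻¹) * (Λf * γ) * (1 + 4 * γ)) * (1 + 4 * v) * (4 * v) + 4 * ((1 + w⁻¹) * (Λf * γ))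
    ∀ (φ : Tor M → Fin d → ℂ) (W₀ : Tor (fine (L ^ k) M) → Fin d → ℂ), QvL (L ^ k) M (nestLv L M R' k) W₀ = φ →
      (∀ W, QvL (L ^ k) M (nestLv L M R' k) W = φ →
        ScV (L ^ k) M (Rlev L M R' k) (projG (fine (L ^ k) M) (Rlev L M R' k) (LinearMap.ker (avgOp (L ^ k) M (taxiTv (L ^ k) M (Rlev L M R' k))))) W₀
          ≤ ScV (L ^ k) M (Rlev L M R' k) (projG (fine (L ^ k) M) (Rlev L M R' k) (LinearMap.ker (avgOp (L ^ k) M (taxiTv (L ^ k) M (Rlev L M R' k))))) W) →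
      ∃ g, QvL (L ^ k) M (nestLv L M R' k) (QvL L (fine (L ^ k) M) (lineT L (fine (L ^ k) M) (taxiTv L (fine (L ^ k) M) (R' k)) (R' k)) g) = φ ∧
        SfV (L ^ k) L M (R' k)
            (fun W' => projG (fine (L ^ (k + 1)) M) (Rlev L M R' (k + 1)) (LinearMap.ker (avgOp (L ^ (k + 1)) M (taxiTv (L ^ (k + 1)) M (Rlev L M R' (k + 1)))))
              (W' ∘ sites (L ^ k) L M)) g
          ≤ (Real.sqrt (ScV (L ^ k) M (Rlev L M R' k) (projG (fine (L ^ k) M) (Rlev L M R' k) (LinearMap.ker (avgOp (L ^ k) M (taxiTv (L ^ k) M (Rlev L M R' k))))) W₀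
                + ((A - 1) + A * ε + B)
                  * (ScV (L ^ k) M (Rlev L M R' k) (projG (fine (L ^ k) M) (Rlev L M R' k) (LinearMap.ker (avgOp (L ^ k) M (taxiTv (L ^ k) M (Rlev L M R' k))))) W₀
                    + nsqV M φ))
              + (Real.sqrt A * δ') * Real.sqrt (qWV (L ^ k) M W₀)) ^ 2 := by
  intro v γ Λf A B
  -- the constants are nonnegative
  have hκ : 0 ≤ 2 * (1 + CD) := by positivity
  have hκ' : 0 ≤ 2 * (CD' + d * ((((L ^ (k + 1) : ℕ) : ℝ)) ^ 2 * b k) * 64) := by positivity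
  have hv0 : 0 ≤ v := by
    have := revPC_nonneg (d := d) (L ^ k * L) (((d - 1 : ℕ) : ℝ) * ((L - 1 : ℕ) : ℝ) * ((2 * L - 1 : ℕ) : ℝ) * b k + ((d - 1 : ℕ) : ℝ) * ((L ^ k - 1 : ℕ) : ℝ) * a)
    positivity
  have hγ0 : 0 ≤ γ := by
    have : (0 : ℝ) ≤ max (40 * (2 * (1 + CD))) (64 + 40 * (2 * (CD' + d * ((((L ^ (k + 1) : ℕ) : ℝ)) ^ 2 * b k) * 64))) := le_max_of_le_left (by positivity)
    positivity
  have hΛf : 0 ≤ Λf := div_nonneg (lamV_nonneg (Nat.cast_nonneg d) (by positivity)) (sq_nonneg _)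
  -- file 3's transfer with file 4a's three comparison data
  exact hONEm_transfer (L ^ k) L M (R := Rlev L M R' k) (R' := R' k)
    (G := projG (fine (L ^ k) M) (Rlev L M R' k) (LinearMap.ker (avgOp (L ^ k) M (taxiTv (L ^ k) M (Rlev L M R' k)))))
    (G₁' := projG (fine L (fine (L ^ k) M)) (R' k)
      (LinearMap.ker ((avgOp (L ^ k) M (taxiTv (L ^ k) M (Rlev L M R' k))).comp (avgOp L (fine (L ^ k) M) (taxiTv L (fine (L ^ k) M) (R' k))))))
    (G₂' := fun W' => projG (fine (L ^ (k + 1)) M) (Rlev L M R' (k + 1))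
      (LinearMap.ker (avgOp (L ^ (k + 1)) M (taxiTv (L ^ (k + 1)) M (Rlev L M R' (k + 1))))) (W' ∘ sites (L ^ k) L M))
    (Qk := QvL (L ^ k) M (nestLv L M R' k))
    (Q₁ := QvL L (fine (L ^ k) M) (frameT L (fine (L ^ k) M) (taxiTv L (fine (L ^ k) M) (R' k)) (Rlev L M R' k)))
    (Q₂ := QvL L (fine (L ^ k) M) (lineT L (fine (L ^ k) M) (taxiTv L (fine (L ^ k) M) (R' k)) (R' k)))
    (fun W => projG_nonneg _ _ _ W) (fun V => projG_nonneg _ _ _ V) (fun V => projG_nonneg _ _ _ _)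
    (fun A' B' => sqrt_projG_add_le _ _ _ (A' ∘ sites (L ^ k) L M) (B' ∘ sites (L ^ k) L M))
    (QvL_QvL_add (L ^ k) L M (nestLv L M R' k) _) hε hδ' hONEc hu.le hv0 hv hγ0 hγ
    (fun g => hG12_taxi L M hU hb hcoh hM2 k ha0 ha hb0 hsmall hκ hκ' (hGar_succ_oneStep L M hU hb hcoh hM2 k hb0 hsmall hγs hsmall80 hGdiv) hu g)
    (fun g => hQ12_taxi L M hU hb hcoh k hb0 (hPf2_taxi L M hU hb hcoh hM2 k hb0 hsmall hγs hsmall80 hGdiv) g)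
    hΛf (hUBf2_taxi L M hU hb hcoh hd k hb0 hc) hw

end Summit.QuantumFields.BalabanUV.T4Continuum.VariationalColourTaxiTransport

end
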